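import Summits.Ventures.HSemireg.Mod4SiteTags

/-!
# Venture HSemireg — MOD-4 line: the TAGS of THEOREM R_f's middle degree, block `G` (mirror of `Mod4SiteTags.lean`)
# (family (c′) of the proof sheet §4: a block-`G` monomial with a doubled site is killed by `f` and by `E_{Gm}` and tagged by
# `E_{Dm}`; the tags are distinct basis monomials, `C(2n,n) − 2ⁿ` of them)

HONEST FRAMING. Part of the Lean index of the computation cell `pub-hsemireg` (widening group W3, seat w3-mod4-1 gen 5; files
of record `HOME/widen/W3/MOD4-OFFSPLIT-w3mod4.md` §10.2 / §11).  Finite-dimensional exterior algebra over a field ONLY (th-7's wedge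
model): no abelian variety, no sheaf, no Ext group, no semiregularity map; nothing here says that HC, HC_CM or HC_AV holds; no
Literature fact is declared or used; THEOREM R_f is NOT asserted here.  This is the block-`G` mirror of `Mod4SiteTags.lean`
(block `D` ↔ block `G`, `castAdd` ↔ `natAdd`, `a` ↔ `b`), stated and proved separately because th-7's model fixes the block order:
`B_pairG_mul_vW` (`E_t ∧ v = (b·u(t,Dm))·E_{t ∪ Dm}` for `t ⊆ Gm` with a full pair), `map_vW_Sp_pairG`, `finrank_map_vW_Sp_pairG`,
`card_blockG_split`, `card_filter_ge`, `card_selG` (`2ⁿ` pair-free block-`G` `n`-sets), `finrank_tagsG_middle`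
(`dim + 2ⁿ = C(2n,n)`, `b ≠ 0`).  No definitions are introduced.
All statements and proofs: w3-mod4-1 g5 (2026-08-23).  Namespace `Summit.Ventures.HSemireg.Mod4Site`.
-/

namespace Summit.Ventures.HSemireg.Mod4Site

open Module Summit.Ventures.HSemireg.Wedge Summit.Ventures.HSemireg.Wedge.Hankel Summit.Ventures.HSemireg.Wedge.Weil

variable {K : Type*} [Field K] {N : ℕ}

/-! ### §1 A block-`G` monomial with a doubled site -/

/-- for `t ⊆ Gm` containing a full pair `{i, pt i}`: `E_t ∧ v = (b · u(t, Dm)) · E_{t ∪ Dm}`. -/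
theorem B_pairG_mul_vW {p : ℕ} {t : Finset (In N)} (ht : t ⊆ Gm N p) {i : In N} (hi : i ∈ t) (hpi : pt i ∈ t)
    (q : ℕ → K) (a b : K) :
    B K (In N) t * vW K N p q a b = (b * u K t (Dm N p)) • B K (In N) (t ∪ Dm N p) := by
  have hG : ¬ Disjoint t (Gm N p) := fun h => Finset.disjoint_left.mp h hi (ht hi)
  rw [vW_mul_expand, B_mul_f_eq_zero_of_pair K hi hpi, zero_add, B_mul_B, B_mul_B, u_eq_zero K hG, zero_smul, smul_zero,
    zero_add, smul_smul]

/-- the structure constant of a `G`-tag is a unit: `t ⊆ Gm` is disjoint from `Dm`. -/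
lemma u_tagG_ne_zero {p : ℕ} {t : Finset (In N)} (ht : t ⊆ Gm N p) : u K t (Dm N p) ≠ 0 :=
  (u_ne_zero_iff K).mpr ((disjoint_Dm_Gm p).symm.mono_left ht)

/-! ### §2 The span of the tags
Family (c′)'s monomials are the `E_t` with `t ⊆ Gm N p`, `|t| = m`, `t ∋` a full pair — the predicate
`fun t => t ⊆ Gm N p ∧ t.card = m ∧ ∃ i ∈ t, pt i ∈ t` —, and their tags are the `E_{t ∪ Dm}` (no definitions are introduced;
the predicates are written out). -/

/-- **the image of family (c′) is the span of its tags** (`a ≠ 0`). -/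
theorem map_vW_Sp_pairG {p m : ℕ} (q : ℕ → K) (a : K) {b : K} (hb : b ≠ 0) :
    (Sp K (fun t : Finset (In N) => t ⊆ Gm N p ∧ t.card = m ∧ ∃ i ∈ t, pt i ∈ t)).map
        (LinearMap.mulRight K (vW K N p q a b)) =
      Sp K (fun r : Finset (In N) => ∃ t, (t ⊆ Gm N p ∧ t.card = m ∧ ∃ i ∈ t, pt i ∈ t) ∧ r = t ∪ Dm N p) := by
  apply le_antisymm
  · rw [Sp, Submodule.map_span, Submodule.span_le]
    rintro _ ⟨_, ⟨t, ht, rfl⟩, rfl⟩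
    have ht' := ht
    obtain ⟨htD, _, i, hi, hpi⟩ := ht'
    rw [LinearMap.mulRight_apply, B_pairG_mul_vW htD hi hpi]
    exact Submodule.smul_mem _ _ (B_mem_Sp ⟨t, ht, rfl⟩)
  · rw [Sp, Submodule.span_le]
    rintro _ ⟨r, ⟨t, ht, rfl⟩, rfl⟩
    have ht' := ht
    obtain ⟨htD, _, i, hi, hpi⟩ := ht'
    have hu : b * u K t (Dm N p) ≠ 0 := mul_ne_zero hb (u_tagG_ne_zero htD)
    refine ⟨(b * u K t (Dm N p))⁻¹ • B K (In N) t, Submodule.smul_mem _ _ (B_mem_Sp ht), ?_⟩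
    rw [LinearMap.mulRight_apply, smul_mul_assoc, B_pairG_mul_vW htD hi hpi, smul_smul, inv_mul_cancel₀ hu, one_smul]

/-- **the tags are distinct basis monomials:** `dim(family (c′) ∧ v) = #{t ⊆ Dm : |t| = m, t ∋ a full pair}` (`a ≠ 0`). -/
theorem finrank_map_vW_Sp_pairG {p m : ℕ} (q : ℕ → K) (a : K) {b : K} (hb : b ≠ 0)
    [DecidablePred (fun t : Finset (In N) => t ⊆ Gm N p ∧ t.card = m ∧ ∃ i ∈ t, pt i ∈ t)] :
    Module.finrank K ↥((Sp K (fun t : Finset (In N) => t ⊆ Gm N p ∧ t.card = m ∧ ∃ i ∈ t, pt i ∈ t)).map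
        (LinearMap.mulRight K (vW K N p q a b))) =
      (Finset.univ.filter (fun t : Finset (In N) => t ⊆ Gm N p ∧ t.card = m ∧ ∃ i ∈ t, pt i ∈ t)).card := by
  classical
  rw [map_vW_Sp_pairG q a hb, finrank_Sp]
  -- `t ↦ t ∪ Dm` is a bijection from family (c′)'s sets onto the tags
  symm
  refine Finset.card_bij (fun t _ => t ∪ Dm N p) (fun t ht => ?_) (fun t₁ ht₁ t₂ ht₂ h => ?_) (fun r hr => ?_)
  · rw [Finset.mem_filter] at ht ⊢
    exact ⟨Finset.mem_univ _, t, ht.2, rfl⟩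
  · rw [Finset.mem_filter] at ht₁ ht₂
    have h1 : Disjoint t₁ (Dm N p) := (disjoint_Dm_Gm p).symm.mono_left ht₁.2.1
    have h2 : Disjoint t₂ (Dm N p) := (disjoint_Dm_Gm p).symm.mono_left ht₂.2.1
    ext x
    constructor
    · intro hx
      have hx' : x ∈ t₂ ∪ Dm N p := h ▸ Finset.mem_union_left _ hx
      rcases Finset.mem_union.mp hx' with h' | h'
      · exact h'
      · exact (Finset.disjoint_left.mp h1 hx h').elim
    · intro hx
      have hx' : x ∈ t₁ ∪ Dm N p := h.symm ▸ Finset.mem_union_left _ hx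
      rcases Finset.mem_union.mp hx' with h' | h'
      · exact h'
      · exact (Finset.disjoint_left.mp h2 hx h').elim
  · rw [Finset.mem_filter] at hr
    obtain ⟨t, ht, rfl⟩ := hr.2
    exact ⟨t, Finset.mem_filter.mpr ⟨Finset.mem_univ _, ht⟩, rfl⟩

/-! ### §3 The counts in type `(n,n)`, degree `n`: `C(2n,n)` block `n`-sets, `2ⁿ` of them pair-free -/

/-- the `n`-subsets of the block `Gm` (`2n` generators) number `C(2n,n)`; they split into those with a full pair and the
pair-free ones. -/
theorem card_blockG_split (n : ℕ)
    [DecidablePred (fun t : Finset (In (n + n)) => t ⊆ Gm (n + n) n ∧ t.card = n ∧ ∃ i ∈ t, pt i ∈ t)]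
    [DecidablePred (fun t : Finset (In (n + n)) => t ⊆ Gm (n + n) n ∧ t.card = n ∧ ¬ ∃ i ∈ t, pt i ∈ t)] :
    (Finset.univ.filter (fun t : Finset (In (n + n)) => t ⊆ Gm (n + n) n ∧ t.card = n ∧ ∃ i ∈ t, pt i ∈ t)).card +
      (Finset.univ.filter (fun t : Finset (In (n + n)) => t ⊆ Gm (n + n) n ∧ t.card = n ∧ ¬ ∃ i ∈ t, pt i ∈ t)).card =
      (n + n).choose n := by
  classical
  have hD : (Gm (n + n) n).card = n + n := by rw [card_Gm (by omega)]; omega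
  have h1 : (Finset.univ.filter (fun t : Finset (In (n + n)) => t ⊆ Gm (n + n) n ∧ t.card = n ∧ ∃ i ∈ t, pt i ∈ t)) =
      ((Gm (n + n) n).powersetCard n).filter (fun t => ∃ i ∈ t, pt i ∈ t) := by
    ext t; simp only [Finset.mem_filter, Finset.mem_univ, true_and, Finset.mem_powersetCard, and_assoc]
  have h2 : (Finset.univ.filter (fun t : Finset (In (n + n)) => t ⊆ Gm (n + n) n ∧ t.card = n ∧ ¬ ∃ i ∈ t, pt i ∈ t)) =
      ((Gm (n + n) n).powersetCard n).filter (fun t => ¬ ∃ i ∈ t, pt i ∈ t) := by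
    ext t; simp only [Finset.mem_filter, Finset.mem_univ, true_and, Finset.mem_powersetCard, and_assoc]
  rw [h1, h2, Finset.card_filter_add_card_filter_not, Finset.card_powersetCard, hD]

/-- the last `n` pairs, as pair indices: `{c' : Fin 2n // n ≤ c'}` has `n` elements. -/
lemma card_filter_ge (n : ℕ) : (Finset.univ.filter (fun c' : Fin (n + n) => n ≤ (c' : ℕ))).card = n := by
  have h : Finset.univ.filter (fun c' : Fin (n + n) => n ≤ (c' : ℕ)) = Finset.univ.image (Fin.natAdd n) := by
    ext c'
    simp only [Finset.mem_filter, Finset.mem_univ, true_and, Finset.mem_image]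
    constructor
    · intro h; exact ⟨⟨(c' : ℕ) - n, by omega⟩, Fin.ext (by simp; omega)⟩
    · rintro ⟨c, rfl⟩; exact Nat.le_add_right n c
  rw [h, Finset.card_image_of_injective _ (Fin.natAdd_injective _ _), Finset.card_univ, Fintype.card_fin]

/-- **the pair-free block-`G` `n`-sets are the `2ⁿ` selection words** `μ′_{B′}` (one letter from each of the `n` pairs):
bijection with `Fin n → Bool`. -/
theorem card_selG (n : ℕ)
    [DecidablePred (fun t : Finset (In (n + n)) => t ⊆ Gm (n + n) n ∧ t.card = n ∧ ¬ ∃ i ∈ t, pt i ∈ t)] :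
    (Finset.univ.filter (fun t : Finset (In (n + n)) => t ⊆ Gm (n + n) n ∧ t.card = n ∧ ¬ ∃ i ∈ t, pt i ∈ t)).card =
      2 ^ n := by
  classical
  -- the letter chosen in pair `c` by `f`
  set L : (Fin n → Bool) → Fin n → In (n + n) :=
    fun f c => if f c then yJ (n + n) (Fin.natAdd n c) else xJ (n + n) (Fin.natAdd n c) with hL
  have hprL : ∀ f c, pr (L f c) = Fin.natAdd n c := by
    intro f c; simp only [hL]; split_ifs <;> simp
  have hLinj : ∀ f, Function.Injective (L f) := by
    intro f c d h
    have := congrArg pr h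
    rw [hprL, hprL] at this
    exact Fin.natAdd_injective _ _ this
  have hLmem : ∀ f c, L f c ∈ Gm (n + n) n := by
    intro f c; rw [mem_Gm_iff, hprL]; exact Nat.le_add_right n c
  have hLy : ∀ f c, (L f c = yJ (n + n) (Fin.natAdd n c) ↔ f c = true) := by
    intro f c; simp only [hL]
    constructor
    · intro h; by_contra hf; rw [if_neg hf] at h; exact xJ_ne_yJ _ _ h
    · intro h; rw [if_pos h]
  set φ : (Fin n → Bool) → Finset (In (n + n)) := fun f => Finset.univ.image (L f) with hφ
  have key : ∀ f c, (yJ (n + n) (Fin.natAdd n c) ∈ φ f ↔ f c = true) := by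
    intro f c
    simp only [hφ, Finset.mem_image, Finset.mem_univ, true_and]
    constructor
    · rintro ⟨d, hd⟩
      have hdc : d = c := by
        have := congrArg pr hd; rw [hprL, pr_yJ] at this; exact Fin.natAdd_injective _ _ this
      subst hdc
      exact (hLy f d).mp hd
    · intro h; exact ⟨c, (hLy f c).mpr h⟩
  have hφinj : Function.Injective φ := by
    intro f g h
    funext c
    have h1 := key f c; rw [h] at h1
    have h2 := key g c
    cases hf : f c <;> cases hg : g c
    · rfl
    · exact absurd (h1.mp (h2.mpr hg)) (by rw [hf]; exact Bool.false_ne_true)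
    · exact absurd (h2.mp (h1.mpr hf)) (by rw [hg]; exact Bool.false_ne_true)
    · rfl
  have himage : Finset.univ.image φ =
      Finset.univ.filter (fun t : Finset (In (n + n)) => t ⊆ Gm (n + n) n ∧ t.card = n ∧ ¬ ∃ i ∈ t, pt i ∈ t) := by
    ext t
    simp only [Finset.mem_image, Finset.mem_univ, true_and, Finset.mem_filter]
    constructor
    · rintro ⟨f, rfl⟩
      refine ⟨fun x hx => ?_, ?_, ?_⟩
      · obtain ⟨c, -, rfl⟩ := Finset.mem_image.mp hx; exact hLmem f c
      · rw [Finset.card_image_of_injective _ (hLinj f), Finset.card_univ, Fintype.card_fin]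
      · rintro ⟨i, hi, hpi⟩
        obtain ⟨c, -, rfl⟩ := Finset.mem_image.mp hi
        obtain ⟨d, -, hd⟩ := Finset.mem_image.mp hpi
        have hdc : d = c := by
          have := congrArg pr hd; rw [hprL, pr_pt, hprL] at this; exact Fin.natAdd_injective _ _ this
        subst hdc
        exact pt_ne_self _ hd.symm
    · rintro ⟨hDm, hcard, hnp⟩
      refine ⟨fun c => decide (yJ (n + n) (Fin.natAdd n c) ∈ t), ?_⟩
      -- every pair `c < n` meets `t` exactly once
      have hinj : Set.InjOn pr (t : Set (In (n + n))) := by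
        intro i hi j hj hij
        rcases eq_or_eq_pt_of_pr_eq hij with h | h
        · exact h.symm
        · exact absurd ⟨i, hi, h ▸ hj⟩ hnp
      have him : t.image pr = Finset.univ.filter (fun c' : Fin (n + n) => n ≤ (c' : ℕ)) := by
        apply Finset.eq_of_subset_of_card_le
        · intro c' hc'
          obtain ⟨i, hi, rfl⟩ := Finset.mem_image.mp hc'
          exact Finset.mem_filter.mpr ⟨Finset.mem_univ _, (mem_Gm_iff i).mp (hDm hi)⟩
        · rw [card_filter_ge, Finset.card_image_of_injOn hinj, hcard]
      have hmeet : ∀ c : Fin n, xJ (n + n) (Fin.natAdd n c) ∈ t ∨ yJ (n + n) (Fin.natAdd n c) ∈ t := by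
        intro c
        have hc : Fin.natAdd n c ∈ t.image pr := by
          rw [him]; exact Finset.mem_filter.mpr ⟨Finset.mem_univ _, Nat.le_add_right n c⟩
        obtain ⟨i, hi, hic⟩ := Finset.mem_image.mp hc
        rcases eq_xJ_or_eq_yJ i with h | h
        · left; rw [← hic, ← h]; exact hi
        · right; rw [← hic, ← h]; exact hi
      apply Finset.eq_of_subset_of_card_le
      · intro x hx
        obtain ⟨c, -, rfl⟩ := Finset.mem_image.mp hx
        by_cases hc : yJ (n + n) (Fin.natAdd n c) ∈ t
        · have : L (fun c => decide (yJ (n + n) (Fin.natAdd n c) ∈ t)) c = yJ (n + n) (Fin.natAdd n c) :=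
            (hLy (fun c => decide (yJ (n + n) (Fin.natAdd n c) ∈ t)) c).mpr (decide_eq_true hc)
          rw [this]; exact hc
        · have : L (fun c => decide (yJ (n + n) (Fin.natAdd n c) ∈ t)) c = xJ (n + n) (Fin.natAdd n c) := by
            simp only [hL]; rw [if_neg (by simpa using hc)]
          rw [this]; exact (hmeet c).resolve_right hc
      · rw [hcard, Finset.card_image_of_injective _ (hLinj _), Finset.card_univ, Fintype.card_fin]
  rw [← himage, Finset.card_image_of_injective _ hφinj, Finset.card_univ, Fintype.card_fun, Fintype.card_bool,
    Fintype.card_fin]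

/-- **FAMILY (c′) OF THE MIDDLE DEGREE CONTRIBUTES `C(2n,n) − 2ⁿ`** (type `(n,n)`, degree `n`, `a ≠ 0`):
`dim(span{E_t : t ⊆ Dm, |t| = n, t ∋ a full pair} ∧ v) + 2ⁿ = C(2n,n)`; the block-`D` statement is `Mod4SiteTags.finrank_tags_middle`. -/
theorem finrank_tagsG_middle (n : ℕ) (q : ℕ → K) (a : K) {b : K} (hb : b ≠ 0)
    [DecidablePred (fun t : Finset (In (n + n)) => t ⊆ Gm (n + n) n ∧ t.card = n ∧ ∃ i ∈ t, pt i ∈ t)] :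
    Module.finrank K ↥((Sp K (fun t : Finset (In (n + n)) => t ⊆ Gm (n + n) n ∧ t.card = n ∧ ∃ i ∈ t, pt i ∈ t)).map
        (LinearMap.mulRight K (vW K (n + n) n q a b))) + 2 ^ n = (n + n).choose n := by
  classical
  rw [finrank_map_vW_Sp_pairG q a hb, ← card_selG n]
  convert card_blockG_split n using 2

end Summit.Ventures.HSemireg.Mod4Site
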